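import Mathlib
import Literature.Computability.AlgebraicComplexity.ArithCircuitProofs

/-!
# Crux `DivisionGap.TriangularDimersDivisionEasy` (stmt-ValiantsHypothesis-5067), line `diagonal-spider-shuffling` —
registered stub `stub_freeInitialForms`

INITIAL FORMS ARE FREE over `ℝ≥0`: the lowest weighted-homogeneous component of a polynomial with
non-negative coefficients costs no more (fan-in-two monotone arithmetic circuit size `complexity`)
than the polynomial itself (folklore of monotone arithmetic circuit complexity, e.g.
Jukna–Seiwert / Sergeev: "taking the lowest (or highest) homogeneous part is free for monotone
circuits").

## Proof

* `InitialForm.complexity_map_le_of_trichotomy` (generic, any commutative semiring): if a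
  self-map `Φ` of `MvPolynomial σ k` fixes variables and constants, is multiplicative, and on every
  sum takes one of the three values `Φ q + Φ r`, `Φ q`, `Φ r`, then `complexity (Φ p) ≤ complexity p`:
  a minimal fan-in-two circuit for `p` is rebuilt gate by gate with the same shape (product gates
  unchanged, sum gates keep or zero each coefficient), and the new value list is the old one mapped
  by `Φ` (induction along the left fold `ArithCircuit.gateValues`).
* The initial-form map `Φ q = weightedHomogeneousComponent w (ord q) q`, where `ord q` is the
  weighted order of `q` viewed as a power series (`MvPowerSeries.weightedOrder`), has these
  properties over `ℝ≥0`: multiplicativity is Mathlib's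
  `MvPowerSeries.weightedOrder_mul` / `weightedHomogeneousComponent_mul_of_le_weightedOrder`
  (no zero divisors), and the trichotomy on sums holds because `ℝ≥0` has no additive cancellation.
* Finally, under the hypothesis that every monomial of `p` has weight `≥ d`, the component of weight
  `d` is either `0` (free, `complexity_C`) or exactly the initial form of `p`.

The file declares no `def`: the map `Φ` is passed around as a hypothesis `hΦ : ∀ q, Φ q = …`.
-/

-- `Summit.ValiantsHypothesis.ValiantsHypothesis.…` is the tree's mandated single-conjunct layout (Sub = Summit).
set_option linter.dupNamespace false

namespace Summit.ValiantsHypothesis.ValiantsHypothesis.Theorems.TriangularDimersDivisionEasy.Shuffling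

open scoped BigOperators NNReal
open Finset MvPolynomial Literature.Computability.AlgebraicComplexity

noncomputable section

namespace InitialForm
/-! ### Helper lemmas for `stub_freeInitialForms` (this stub's private namespace) -/

open ArithCircuit

section Generic

/-! #### Rebuilding a circuit along a multiplicative, sum-trichotomous self-map `Φ` -/

variable {k : Type*} [CommSemiring k] {σ : Type*} {Φ : MvPolynomial σ k → MvPolynomial σ k}

/-- An operand read against the `Φ`-mapped value list is `Φ` of its old value (variables and
constants are fixed by `Φ`, and the junk value `0 = C 0` too). [folklore] -/
theorem operand_eval_map (hX : ∀ i, Φ (X i) = X i) (hC : ∀ c, Φ (C c) = C c)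
    (vals : List (MvPolynomial σ k)) (u : Operand k σ) :
    u.eval (vals.map Φ) = Φ (u.eval vals) := by
  cases u with
  | var i => exact (hX i).symm
  | const c => exact (hC c).symm
  | gate j =>
    have h0 : Φ 0 = 0 := by simpa only [C_0] using hC 0
    simp only [Operand.eval_gate, List.getD_eq_getElem?_getD, List.getElem?_map]
    cases vals[j]? <;> simp [h0]

/-- Sum gates: keeping or zeroing each coefficient of `∑ cᵢ • uᵢ` realises `Φ` of the old value
against the `Φ`-mapped value list, by the trichotomy of `Φ` on binary sums. [folklore] -/
theorem exists_sumArgs_map (hX : ∀ i, Φ (X i) = X i) (hC : ∀ c, Φ (C c) = C c)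
    (hmul : ∀ q r, Φ (q * r) = Φ q * Φ r)
    (hadd : ∀ q r, Φ (q + r) = Φ q + Φ r ∨ Φ (q + r) = Φ q ∨ Φ (q + r) = Φ r)
    (vals : List (MvPolynomial σ k)) (args : List (k × Operand k σ)) :
    ∃ args' : List (k × Operand k σ), args'.length = args.length ∧
      (args'.map fun a => a.1 • a.2.eval (vals.map Φ)).sum =
        Φ (args.map fun a => a.1 • a.2.eval vals).sum := by
  have h0 : Φ 0 = 0 := by simpa only [C_0] using hC 0
  induction args with
  | nil => exact ⟨[], rfl, by simp [h0]⟩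
  | cons a rest ih =>
    obtain ⟨rest', hlen, hval⟩ := ih
    have hsm : Φ (a.1 • a.2.eval vals) = a.1 • a.2.eval (vals.map Φ) := by
      rw [smul_eq_C_mul, hmul, hC, C_mul', operand_eval_map hX hC]
    simp only [List.map_cons, List.sum_cons]
    rcases hadd (a.1 • a.2.eval vals) (rest.map fun a => a.1 • a.2.eval vals).sum with h | h | h
    · refine ⟨a :: rest', by simp [hlen], ?_⟩
      rw [List.map_cons, List.sum_cons, h, hsm, hval]
    · refine ⟨a :: rest.map (fun b => ((0 : k), b.2)), by simp, ?_⟩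
      rw [List.map_cons, List.sum_cons, h, hsm]
      simp [Function.comp_def, List.map_const', List.sum_replicate]
    · refine ⟨((0 : k), a.2) :: rest', by simp [hlen], ?_⟩
      rw [List.map_cons, List.sum_cons, h, zero_smul, zero_add, hval]

/-- Every gate can be replaced by a gate of the same fan-in whose value against the `Φ`-mapped
value list is `Φ` of the old value (product gates are kept: `Φ` is multiplicative). [folklore] -/
theorem exists_gate_map (hX : ∀ i, Φ (X i) = X i) (hC : ∀ c, Φ (C c) = C c)
    (hmul : ∀ q r, Φ (q * r) = Φ q * Φ r)
    (hadd : ∀ q r, Φ (q + r) = Φ q + Φ r ∨ Φ (q + r) = Φ q ∨ Φ (q + r) = Φ r)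
    (vals : List (MvPolynomial σ k)) (g : Gate k σ) :
    ∃ g' : Gate k σ, g'.fanIn = g.fanIn ∧ g'.eval (vals.map Φ) = Φ (g.eval vals) := by
  cases g with
  | sum args =>
    obtain ⟨args', hlen, hval⟩ := exists_sumArgs_map hX hC hmul hadd vals args
    exact ⟨.sum args', by simp [Gate.fanIn, Gate.args, hlen], hval⟩
  | prod args =>
    refine ⟨.prod args, rfl, ?_⟩
    simp only [Gate.eval]
    induction args with
    | nil => simpa only [List.map_nil, List.prod_nil, C_1] using (hC 1).symm
    | cons u rest ih =>
      rw [List.map_cons, List.prod_cons, List.map_cons, List.prod_cons, hmul, ih,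
        operand_eval_map hX hC]

/-- The whole gate list can be rebuilt, gate for gate and fan-in for fan-in, so that the left fold
of values started from a `Φ`-mapped prefix is the `Φ`-mapped old fold. [folklore] -/
theorem exists_gates_map (hX : ∀ i, Φ (X i) = X i) (hC : ∀ c, Φ (C c) = C c)
    (hmul : ∀ q r, Φ (q * r) = Φ q * Φ r)
    (hadd : ∀ q r, Φ (q + r) = Φ q + Φ r ∨ Φ (q + r) = Φ q ∨ Φ (q + r) = Φ r)
    (gs : List (Gate k σ)) (vals : List (MvPolynomial σ k)) :
    ∃ gs' : List (Gate k σ), gs'.length = gs.length ∧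
      (∀ g' ∈ gs', ∃ g ∈ gs, g'.fanIn = g.fanIn) ∧
      gs'.foldl (fun vals g => vals ++ [g.eval vals]) (vals.map Φ) =
        (gs.foldl (fun vals g => vals ++ [g.eval vals]) vals).map Φ := by
  induction gs generalizing vals with
  | nil => exact ⟨[], rfl, by simp, rfl⟩
  | cons g rest ih =>
    obtain ⟨g', hfan, hval⟩ := exists_gate_map hX hC hmul hadd vals g
    obtain ⟨rest', hlen, hfan', hfold⟩ := ih (vals ++ [g.eval vals])
    refine ⟨g' :: rest', by simp [hlen], fun x hx => ?_, ?_⟩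
    · rcases List.mem_cons.1 hx with rfl | hx
      · exact ⟨g, List.mem_cons_self, hfan⟩
      · obtain ⟨g₀, hg₀, h⟩ := hfan' x hx
        exact ⟨g₀, List.mem_cons_of_mem _ hg₀, h⟩
    · rw [List.foldl_cons, List.foldl_cons, hval, ← hfold, List.map_append, List.map_singleton]

/-- GENERIC TRANSFER: a self-map `Φ` fixing variables and constants, multiplicative, and taking on
each sum one of the values `Φ q + Φ r`, `Φ q`, `Φ r`, does not increase fan-in-two circuit
complexity — rebuild a minimal circuit (`exists_computes_size_eq_complexity`) along `Φ`. [folklore] -/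
theorem complexity_map_le_of_trichotomy (hX : ∀ i, Φ (X i) = X i) (hC : ∀ c, Φ (C c) = C c)
    (hmul : ∀ q r, Φ (q * r) = Φ q * Φ r)
    (hadd : ∀ q r, Φ (q + r) = Φ q + Φ r ∨ Φ (q + r) = Φ q ∨ Φ (q + r) = Φ r)
    (p : MvPolynomial σ k) : complexity (Φ p) ≤ complexity p := by
  obtain ⟨P, h2, hc, hs⟩ := exists_computes_size_eq_complexity p
  obtain ⟨gs', hlen, hfan, hfold⟩ := exists_gates_map hX hC hmul hadd P.gates []
  rw [List.map_nil] at hfold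
  have h2' : (⟨gs', P.output⟩ : ArithCircuit k σ).IsFanInTwo := fun g' hg' => by
    obtain ⟨g, hg, h⟩ := hfan g' hg'
    rw [h]
    exact h2 g hg
  have hc' : (⟨gs', P.output⟩ : ArithCircuit k σ).Computes (Φ p) := by
    change P.output.eval (gateValues gs') = Φ p
    unfold gateValues
    rw [hfold, operand_eval_map hX hC]
    exact congrArg Φ hc
  calc complexity (Φ p) ≤ (⟨gs', P.output⟩ : ArithCircuit k σ).size := complexity_le_size h2' hc'
    _ = P.size := hlen
    _ = complexity p := hs

end Generic

section Order

/-! #### The weighted order of a polynomial, through `MvPowerSeries.weightedOrder` -/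

variable {R : Type*} [CommSemiring R] {σ : Type*} {w : σ → ℕ}

/-- The coercion to power series commutes with taking weighted homogeneous components. [folklore] -/
theorem coe_weightedHomogeneousComponent (n : ℕ) (q : MvPolynomial σ R) :
    ((weightedHomogeneousComponent w n q : MvPolynomial σ R) : MvPowerSeries σ R) =
      MvPowerSeries.weightedHomogeneousComponent w n (q : MvPowerSeries σ R) := by
  ext d
  simp only [MvPolynomial.coeff_coe, MvPowerSeries.coeff_weightedHomogeneousComponent,
    MvPolynomial.coeff_weightedHomogeneousComponent]

/-- A non-zero polynomial has finite weighted order. [folklore] -/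
theorem exists_weightedOrder_eq_nat {q : MvPolynomial σ R} (hq : q ≠ 0) :
    ∃ n : ℕ, (q : MvPowerSeries σ R).weightedOrder w = n := by
  have h : (q : MvPowerSeries σ R).weightedOrder w ≠ ⊤ := by
    rwa [Ne, MvPowerSeries.weightedOrder_eq_top_iff, MvPolynomial.coe_eq_zero_iff]
  obtain ⟨n, hn⟩ := ENat.ne_top_iff_exists.mp h
  exact ⟨n, hn.symm⟩

/-- The weighted order of a polynomial is `n` as soon as `n` is attained by, and is a lower bound
for, the weights of the monomials in its support. [folklore] -/
theorem weightedOrder_eq_of {q : MvPolynomial σ R} {n : ℕ}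
    (h1 : ∃ d ∈ q.support, Finsupp.weight w d = n) (h2 : ∀ d ∈ q.support, n ≤ Finsupp.weight w d) :
    (q : MvPowerSeries σ R).weightedOrder w = n := by
  rw [MvPowerSeries.weightedOrder_eq_nat]
  refine ⟨?_, fun d hd => ?_⟩
  · obtain ⟨d, hd, hdn⟩ := h1
    exact ⟨d, by rwa [MvPolynomial.coeff_coe, ← MvPolynomial.mem_support_iff], hdn⟩
  · rw [MvPolynomial.coeff_coe, ← MvPolynomial.notMem_support_iff]
    exact fun hmem => absurd hd (not_lt.mpr (h2 d hmem))

/-- Components strictly below the weighted order vanish. [folklore] -/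
theorem weightedHomogeneousComponent_eq_zero_of_lt {q : MvPolynomial σ R} {n : ℕ}
    (h : (n : ℕ∞) < (q : MvPowerSeries σ R).weightedOrder w) :
    weightedHomogeneousComponent w n q = 0 := by
  rw [← MvPolynomial.coe_eq_zero_iff, coe_weightedHomogeneousComponent]
  exact MvPowerSeries.weightedHomogeneousComponent_of_lt_weightedOrder_eq_zero h

end Order

section Ini

/-! #### The initial form `Φ q = weightedHomogeneousComponent w (ord q) q` over `ℝ≥0` -/

variable {σ : Type} {w : σ → ℕ} {Φ : MvPolynomial σ ℝ≥0 → MvPolynomial σ ℝ≥0}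

/-- The initial form of a weighted homogeneous polynomial is the polynomial itself (in particular
`Φ (X i) = X i` and `Φ (C c) = C c`). [folklore] -/
theorem ini_of_isWeightedHomogeneous
    (hΦ : ∀ q, Φ q = weightedHomogeneousComponent w
      ((q : MvPowerSeries σ ℝ≥0).weightedOrder w).toNat q)
    {q : MvPolynomial σ ℝ≥0} {n : ℕ} (hq : IsWeightedHomogeneous w q n) : Φ q = q := by
  by_cases h0 : q = 0
  · rw [hΦ, h0, map_zero]
  · have hord : (q : MvPowerSeries σ ℝ≥0).weightedOrder w = n := by
      refine weightedOrder_eq_of ?_ fun d hd => (hq (mem_support_iff.mp hd)).ge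
      obtain ⟨d, hd⟩ := MvPolynomial.ne_zero_iff.mp h0
      exact ⟨d, mem_support_iff.mpr hd, hq hd⟩
    rw [hΦ, hord, ENat.toNat_coe, weightedHomogeneousComponent_eq_self hq]

/-- The initial form is multiplicative over `ℝ≥0` (no zero divisors: the lowest components of the
factors multiply to the non-zero lowest component of the product;
`MvPowerSeries.weightedOrder_mul`). [folklore] -/
theorem ini_mul
    (hΦ : ∀ q, Φ q = weightedHomogeneousComponent w
      ((q : MvPowerSeries σ ℝ≥0).weightedOrder w).toNat q)
    (q r : MvPolynomial σ ℝ≥0) : Φ (q * r) = Φ q * Φ r := by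
  by_cases hq : q = 0
  · rw [hΦ (q * r), hΦ q, hq, zero_mul, map_zero, zero_mul]
  by_cases hr : r = 0
  · rw [hΦ (q * r), hΦ r, hr, mul_zero, map_zero, mul_zero]
  obtain ⟨a, ha⟩ := exists_weightedOrder_eq_nat (w := w) hq
  obtain ⟨b, hb⟩ := exists_weightedOrder_eq_nat (w := w) hr
  have hab : ((q * r : MvPolynomial σ ℝ≥0) : MvPowerSeries σ ℝ≥0).weightedOrder w =
      (a + b : ℕ) := by
    rw [MvPolynomial.coe_mul, MvPowerSeries.weightedOrder_mul, ha, hb, Nat.cast_add]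
  rw [hΦ (q * r), hΦ q, hΦ r, hab, ha, hb, ENat.toNat_coe, ENat.toNat_coe, ENat.toNat_coe]
  apply MvPolynomial.coe_injective σ ℝ≥0
  rw [MvPolynomial.coe_mul, coe_weightedHomogeneousComponent, coe_weightedHomogeneousComponent,
    coe_weightedHomogeneousComponent, MvPolynomial.coe_mul]
  exact MvPowerSeries.weightedHomogeneousComponent_mul_of_le_weightedOrder ha.ge hb.ge

/-- One-sided sum rule: if `q` has strictly smaller weighted order than `r`, the initial form of
`q + r` is that of `q` (`MvPowerSeries.weightedOrder_add_of_weightedOrder_ne`). [folklore] -/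
theorem ini_add_of_lt
    (hΦ : ∀ q, Φ q = weightedHomogeneousComponent w
      ((q : MvPowerSeries σ ℝ≥0).weightedOrder w).toNat q)
    {q r : MvPolynomial σ ℝ≥0} {a b : ℕ} (ha : (q : MvPowerSeries σ ℝ≥0).weightedOrder w = a)
    (hb : (r : MvPowerSeries σ ℝ≥0).weightedOrder w = b) (hab : a < b) : Φ (q + r) = Φ q := by
  have hqr : ((q + r : MvPolynomial σ ℝ≥0) : MvPowerSeries σ ℝ≥0).weightedOrder w = a := by
    rw [MvPolynomial.coe_add, MvPowerSeries.weightedOrder_add_of_weightedOrder_ne w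
      (by rw [ha, hb]; exact_mod_cast hab.ne), ha, hb]
    exact min_eq_left (by exact_mod_cast hab.le)
  rw [hΦ (q + r), hΦ q, hqr, ha, ENat.toNat_coe, map_add,
    weightedHomogeneousComponent_eq_zero_of_lt (q := r) (by rw [hb]; exact_mod_cast hab), add_zero]

/-- TRICHOTOMY ON SUMS over `ℝ≥0`: the initial form of `q + r` is `Φ q + Φ r` (equal orders; no
additive cancellation in `ℝ≥0`), or `Φ q`, or `Φ r` (the summand of smaller order; also the
degenerate cases `q = 0` / `r = 0`). [folklore] -/
theorem ini_add
    (hΦ : ∀ q, Φ q = weightedHomogeneousComponent w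
      ((q : MvPowerSeries σ ℝ≥0).weightedOrder w).toNat q)
    (q r : MvPolynomial σ ℝ≥0) :
    Φ (q + r) = Φ q + Φ r ∨ Φ (q + r) = Φ q ∨ Φ (q + r) = Φ r := by
  by_cases hq : q = 0
  · exact Or.inr (Or.inr (by rw [hq, zero_add]))
  by_cases hr : r = 0
  · exact Or.inr (Or.inl (by rw [hr, add_zero]))
  obtain ⟨a, ha⟩ := exists_weightedOrder_eq_nat (w := w) hq
  obtain ⟨b, hb⟩ := exists_weightedOrder_eq_nat (w := w) hr
  rcases lt_trichotomy a b with hab | rfl | hab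
  · exact Or.inr (Or.inl (ini_add_of_lt hΦ ha hb hab))
  · refine Or.inl ?_
    have hqr : ((q + r : MvPolynomial σ ℝ≥0) : MvPowerSeries σ ℝ≥0).weightedOrder w = a := by
      apply le_antisymm
      · obtain ⟨⟨d, hd, hda⟩, -⟩ := (MvPowerSeries.weightedOrder_eq_nat w).mp ha
        rw [← hda]
        apply MvPowerSeries.weightedOrder_le
        rw [MvPolynomial.coeff_coe] at hd ⊢
        rw [coeff_add]
        exact fun h => hd (add_eq_zero.mp h).1
      · have h := MvPowerSeries.min_weightedOrder_le_add w (f := (q : MvPowerSeries σ ℝ≥0))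
          (g := (r : MvPowerSeries σ ℝ≥0))
        rwa [ha, hb, min_self, ← MvPolynomial.coe_add] at h
    rw [hΦ (q + r), hΦ q, hΦ r, hqr, ha, hb, ENat.toNat_coe, map_add]
  · refine Or.inr (Or.inr ?_)
    rw [add_comm q r]
    exact ini_add_of_lt hΦ hb ha hab

/-- INITIAL FORMS ARE FREE: `complexity (Φ p) ≤ complexity p` for the initial-form map over `ℝ≥0`
(generic transfer `complexity_map_le_of_trichotomy` fed with `ini_of_isWeightedHomogeneous`,
`ini_mul`, `ini_add`). [folklore] -/
theorem complexity_ini_le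
    (hΦ : ∀ q, Φ q = weightedHomogeneousComponent w
      ((q : MvPowerSeries σ ℝ≥0).weightedOrder w).toNat q)
    (p : MvPolynomial σ ℝ≥0) : complexity (Φ p) ≤ complexity p :=
  complexity_map_le_of_trichotomy
    (fun i => ini_of_isWeightedHomogeneous hΦ (isWeightedHomogeneous_X ℝ≥0 w i))
    (fun c => ini_of_isWeightedHomogeneous hΦ (isWeightedHomogeneous_C w c))
    (ini_mul hΦ) (ini_add hΦ) p

end Ini

end InitialForm

open InitialForm in
/-- **Registered stub `stub_freeInitialForms`** (crux stmt-ValiantsHypothesis-5067, line `diagonal-spider-shuffling`).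
INITIAL FORMS ARE FREE for monotone circuits: if every monomial of `p : MvPolynomial σ ℝ≥0` has
`w`-weight at least `d`, then the weighted homogeneous component of `p` of weight `d` (its initial
form, or `0`) has fan-in-two circuit complexity over `ℝ≥0` at most that of `p`. Proof: rebuild a
minimal circuit for `p` gate by gate, replacing every gate value by its lowest weighted
homogeneous component — product gates stay products (no zero divisors), sum gates keep exactly
the summands of minimal order (no cancellation in `ℝ≥0`); inputs and constants are untouched
(folklore of monotone arithmetic circuit lower bounds, cf. Jukna–Seiwert–Sergeev; Bürgisser 2000,
Def. 2.1 for the circuit model). [folklore] -/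
theorem stub_freeInitialForms :
    ∀ (σ : Type) (w : σ → ℕ) (d : ℕ) (p : MvPolynomial σ ℝ≥0),
      (∀ m ∈ p.support, d ≤ Finsupp.weight w m) →
        complexity (weightedHomogeneousComponent w d p) ≤ complexity p := by
  intro σ w d p H
  by_cases h0 : weightedHomogeneousComponent w d p = 0
  · rw [h0, ← C_0, complexity_C_holds]
    exact Nat.zero_le _
  · obtain ⟨m, hm⟩ := MvPolynomial.ne_zero_iff.mp h0
    rw [coeff_weightedHomogeneousComponent] at hm
    have hmd : Finsupp.weight w m = d := by
      by_contra h
      exact hm (if_neg h)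
    rw [if_pos hmd] at hm
    have hord : (p : MvPowerSeries σ ℝ≥0).weightedOrder w = d :=
      weightedOrder_eq_of ⟨m, mem_support_iff.mpr hm, hmd⟩ H
    have key := complexity_ini_le (w := w)
      (Φ := fun q : MvPolynomial σ ℝ≥0 =>
        weightedHomogeneousComponent w ((q : MvPowerSeries σ ℝ≥0).weightedOrder w).toNat q)
      (fun _ => rfl) p
    rwa [hord, ENat.toNat_coe] at key

end

end Summit.ValiantsHypothesis.ValiantsHypothesis.Theorems.TriangularDimersDivisionEasy.Shuffling
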